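import Literature.Computability.AlgebraicComplexity.GroupTheoreticMatMul
import Literature.LinearAlgebra.Subspace.SpanPairCover
import Literature.LinearAlgebra.Subspace.PuncturedLineCones
import HarnessLib

/-!
# STPP families of punctured lines over a finite field: a factor-`q` loss against packing

Topic `Computability/AlgebraicComplexity`, companion of `GroupTheoreticMatMul.lean` (`IsSTPP`,
Cohn–Kleinberg–Szegedy–Umans 2005 Def. 5.1 / Blasiak et al. 2017 Def. 2.2).  A *punctured-line
family* in `H = F^m` (`F` finite, `q = |F|`) is `Aᵢ = F^× aᵢ`, `Bᵢ = F^× bᵢ`, `Cᵢ = F^× cᵢ` with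
`aᵢ, bᵢ, cᵢ ≠ 0`.  The packing bound (`IsSTPP.packing`) allows `N ≤ q^m/(q − 1)² ≈ q^{m−2}` blocks.
Main result of this file (found and proved in the harness, refuter seat on
`AlgebraicSTPPDichotomy.LineFrameBarrier`, 2026-08-15; no published source is known to us):

* `IsSTPP.lineFamily_card_bound` — for `q ≥ 3`, `m ≥ 2`:  `N (q − 1)² (q + 1) + 7 < 7 q^m`, i.e.
  `N < 7 (q^m − 1)/((q − 1)²(q + 1)) ≈ 7 q^{m−3}`: a full factor `(q + 1)/7` below packing.

Proof: the simultaneous triple product property says exactly that the three colour cones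
`𝒮 = ⋃ (Aᵢ − Bᵢ)`, `𝒯 = ⋃ (Bⱼ − Cⱼ)`, `𝒰 = ⋃ (C_k − A_k)` have no zero sum `x + y + z = 0` unless
`i = j = k` (`IsSTPP.sixScalar_of_lineFamily`), and that each block is linearly independent
(`IsSTPP.lineFamily_independent`, `q ≥ 3`); the line lemma
(`Literature.LinearAlgebra.Subspace.cover_of_sixScalar`) then shows that every plane through the
origin is poor in one of the three cones, and the second-moment cover bound
(`Literature.LinearAlgebra.Subspace.card_mul_lt_of_cover`) bounds `|𝒮| = |𝒯| = |𝒰| = N (q − 1)²`.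

Also: `IsSTPP.comp_of_injective` (sub-families of an STPP family are STPP) and
`IsSTPP.three_le_of_lineFamily` (a non-empty punctured-line STPP family needs `m ≥ 3`).
Consumers: `Summits/MatrixMultiplication/…/Theses/AlgebraicSTPPDichotomy` (LineFrameBarrier,
FrameBarrier, and the refutation of ExactLineDesign).  No named fact, no definition.

## References
* H. Cohn, R. Kleinberg, B. Szegedy, C. Umans, FOCS 2005, arXiv:math/0511460, Def. 5.1.
* J. Blasiak, T. Church, H. Cohn, J. A. Grochow, E. Naslund, W. F. Sawin, C. Umans, Discrete
  Analysis 2017:3, arXiv:1605.06702, Def. 2.2 and the packing bound of §2.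
-/

open Submodule Finset Literature.LinearAlgebra.Subspace

namespace Literature.Computability.AlgebraicComplexity

section Reindex
variable {H : Type*} [AddCommGroup H] {N N' : ℕ}

/-- A sub-family (re-indexing along an injection) of an STPP family is STPP. [folklore] -/
theorem IsSTPP.comp_of_injective {A B C : Fin N → Finset H} (h : IsSTPP A B C) (ι : Fin N' → Fin N)
    (hι : Function.Injective ι) : IsSTPP (fun i => A (ι i)) (fun i => B (ι i)) (fun i => C (ι i)) := by
  intro i j k s hs s' hs' t ht t' ht' u hu u' hu' he
  obtain ⟨h1, h2, h3, h4, h5⟩ := h (ι i) (ι j) (ι k) s hs s' hs' t ht t' ht' u hu u' hu' he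
  exact ⟨hι h1, hι h2, h3, h4, h5⟩

end Reindex

section LineFamilies
variable {F : Type*} [Field F] {m N : ℕ}

/-- **The six-scalar form of the STPP for punctured-line families.**  If `Aᵢ = F^× aᵢ`,
`Bᵢ = F^× bᵢ`, `Cᵢ = F^× cᵢ` (`aᵢ, bᵢ, cᵢ ≠ 0`) form an STPP family, then
`(σ aᵢ − τ bᵢ) + (σ' bⱼ − τ' cⱼ) + (σ'' c_k − τ'' a_k) = 0` with all six scalars non-zero forces
`i = j = k` (regroup `(s' − s) + (t' − t) + (u' − u)` as `(s' − t) + (t' − u) + (u' − s)`).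
[folklore] -/
theorem IsSTPP.sixScalar_of_lineFamily (a b c : Fin N → (Fin m → F))
    {A B C : Fin N → Finset (Fin m → F)} (hne : ∀ i, a i ≠ 0 ∧ b i ≠ 0 ∧ c i ≠ 0)
    (hA : ∀ i v, v ∈ A i ↔ v ≠ 0 ∧ ∃ t : F, v = t • a i)
    (hB : ∀ i v, v ∈ B i ↔ v ≠ 0 ∧ ∃ t : F, v = t • b i)
    (hC : ∀ i v, v ∈ C i ↔ v ≠ 0 ∧ ∃ t : F, v = t • c i) (hS : IsSTPP A B C) :
    ∀ (i j k : Fin N) (σ τ σ' τ' σ'' τ'' : F), σ ≠ 0 → τ ≠ 0 → σ' ≠ 0 → τ' ≠ 0 →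
      σ'' ≠ 0 → τ'' ≠ 0 →
      (σ • a i - τ • b i) + (σ' • b j - τ' • c j) + (σ'' • c k - τ'' • a k) = 0 → i = j ∧ j = k := by
  intro i j k σ τ σ' τ' σ'' τ'' hσ hτ hσ' hτ' hσ'' hτ'' hsum
  have memA : ∀ (l : Fin N) (ρ : F), ρ ≠ 0 → ρ • a l ∈ A l := fun l ρ hρ =>
    (hA l _).2 ⟨smul_ne_zero hρ (hne l).1, ρ, rfl⟩
  have memB : ∀ (l : Fin N) (ρ : F), ρ ≠ 0 → ρ • b l ∈ B l := fun l ρ hρ =>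
    (hB l _).2 ⟨smul_ne_zero hρ (hne l).2.1, ρ, rfl⟩
  have memC : ∀ (l : Fin N) (ρ : F), ρ ≠ 0 → ρ • c l ∈ C l := fun l ρ hρ =>
    (hC l _).2 ⟨smul_ne_zero hρ (hne l).2.2, ρ, rfl⟩
  have h := hS i j k (τ'' • a k) (memA k τ'' hτ'') (σ • a i) (memA i σ hσ) (τ • b i) (memB i τ hτ)
    (σ' • b j) (memB j σ' hσ') (τ' • c j) (memC j τ' hτ') (σ'' • c k) (memC k σ'' hσ'')
    (by rw [← hsum]; abel)
  exact ⟨h.1, h.2.1⟩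

/-- **Blocks of a punctured-line STPP family are linearly independent** (from the clause
`i = j = k`, i.e. the triple product property of each block, when `|F| ≥ 3`: every scalar is a
difference of two non-zero scalars):  `α aᵢ + β bᵢ + γ cᵢ = 0 → α = β = γ = 0`. [folklore] -/
theorem IsSTPP.lineFamily_independent [Fintype F] (hq : 3 ≤ Fintype.card F)
    (a b c : Fin N → (Fin m → F)) {A B C : Fin N → Finset (Fin m → F)}
    (hne : ∀ i, a i ≠ 0 ∧ b i ≠ 0 ∧ c i ≠ 0)
    (hA : ∀ i v, v ∈ A i ↔ v ≠ 0 ∧ ∃ t : F, v = t • a i)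
    (hB : ∀ i v, v ∈ B i ↔ v ≠ 0 ∧ ∃ t : F, v = t • b i)
    (hC : ∀ i v, v ∈ C i ↔ v ≠ 0 ∧ ∃ t : F, v = t • c i) (hS : IsSTPP A B C) :
    ∀ (i : Fin N) (α β γ : F), α • a i + β • b i + γ • c i = 0 → α = 0 ∧ β = 0 ∧ γ = 0 := by
  classical
  intro i α β γ hrel
  -- for every scalar `θ` there is `ρ ≠ 0` with `ρ + θ ≠ 0`
  have pick : ∀ θ : F, ∃ ρ : F, ρ ≠ 0 ∧ ρ + θ ≠ 0 := by
    intro θ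
    have hcard : 1 ≤ ((univ : Finset F) \ {0, -θ}).card := by
      have h1 := card_sdiff_add_card_inter (univ : Finset F) {0, -θ}
      have h2 : ((univ : Finset F) ∩ {0, -θ}).card ≤ 2 :=
        (card_le_card inter_subset_right).trans (card_le_two)
      rw [card_univ] at h1
      omega
    obtain ⟨ρ, hρ⟩ := card_pos.1 hcard
    simp only [mem_sdiff, mem_univ, mem_insert, mem_singleton, true_and, not_or] at hρ
    exact ⟨ρ, hρ.1, fun h => hρ.2 (eq_neg_of_add_eq_zero_left h)⟩
  obtain ⟨ρ₁, hρ₁, hρ₁'⟩ := pick α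
  obtain ⟨ρ₂, hρ₂, hρ₂'⟩ := pick β
  obtain ⟨ρ₃, hρ₃, hρ₃'⟩ := pick γ
  have memA : ∀ (ρ : F), ρ ≠ 0 → ρ • a i ∈ A i := fun ρ hρ =>
    (hA i _).2 ⟨smul_ne_zero hρ (hne i).1, ρ, rfl⟩
  have memB : ∀ (ρ : F), ρ ≠ 0 → ρ • b i ∈ B i := fun ρ hρ =>
    (hB i _).2 ⟨smul_ne_zero hρ (hne i).2.1, ρ, rfl⟩
  have memC : ∀ (ρ : F), ρ ≠ 0 → ρ • c i ∈ C i := fun ρ hρ =>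
    (hC i _).2 ⟨smul_ne_zero hρ (hne i).2.2, ρ, rfl⟩
  have h := hS i i i (ρ₁ • a i) (memA ρ₁ hρ₁) ((ρ₁ + α) • a i) (memA _ hρ₁') (ρ₂ • b i)
    (memB ρ₂ hρ₂) ((ρ₂ + β) • b i) (memB _ hρ₂') (ρ₃ • c i) (memC ρ₃ hρ₃) ((ρ₃ + γ) • c i)
    (memC _ hρ₃') (by rw [← hrel]; module)
  obtain ⟨-, -, h1, h2, h3⟩ := h
  refine ⟨?_, ?_, ?_⟩
  · have : α • a i = 0 := by
      have := congrArg (fun v => v - ρ₁ • a i) h1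
      simp only [sub_self, add_smul, add_sub_cancel_left] at this
      exact this.symm
    exact (smul_eq_zero.1 this).resolve_right (hne i).1
  · have : β • b i = 0 := by
      have := congrArg (fun v => v - ρ₂ • b i) h2
      simp only [sub_self, add_smul, add_sub_cancel_left] at this
      exact this.symm
    exact (smul_eq_zero.1 this).resolve_right (hne i).2.1
  · have : γ • c i = 0 := by
      have := congrArg (fun v => v - ρ₃ • c i) h3
      simp only [sub_self, add_smul, add_sub_cancel_left] at this
      exact this.symm
    exact (smul_eq_zero.1 this).resolve_right (hne i).2.2

/-- A non-empty STPP family of punctured lines over a field with `≥ 3` elements lives in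
dimension `m ≥ 3` (each block is linearly independent). [folklore] -/
theorem IsSTPP.three_le_of_lineFamily [Fintype F] (hq : 3 ≤ Fintype.card F) (hN : 0 < N)
    (a b c : Fin N → (Fin m → F)) {A B C : Fin N → Finset (Fin m → F)}
    (hne : ∀ i, a i ≠ 0 ∧ b i ≠ 0 ∧ c i ≠ 0)
    (hA : ∀ i v, v ∈ A i ↔ v ≠ 0 ∧ ∃ t : F, v = t • a i)
    (hB : ∀ i v, v ∈ B i ↔ v ≠ 0 ∧ ∃ t : F, v = t • b i)
    (hC : ∀ i v, v ∈ C i ↔ v ≠ 0 ∧ ∃ t : F, v = t • c i) (hS : IsSTPP A B C) : 3 ≤ m := by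
  have hind := hS.lineFamily_independent hq a b c hne hA hB hC
  let i : Fin N := ⟨0, hN⟩
  have hli : LinearIndependent F ![a i, b i, c i] := by
    rw [Fintype.linearIndependent_iff]
    intro g hg
    have hg' : g 0 • a i + g 1 • b i + g 2 • c i = 0 := by
      simpa [Fin.sum_univ_three] using hg
    obtain ⟨h0, h1, h2⟩ := hind i _ _ _ hg'
    intro l
    fin_cases l <;> assumption
  simpa using hli.fintype_card_le_finrank

/-- **STPP families of punctured lines lose a factor `(q + 1)/7` against packing.**  Let `F` be a
finite field with `q ≥ 3` elements, `m ≥ 2`, and let `Aᵢ = F^× aᵢ`, `Bᵢ = F^× bᵢ`, `Cᵢ = F^× cᵢ`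
(`aᵢ, bᵢ, cᵢ ≠ 0`, `i < N`) be an STPP family in `F^m`.  Then
`N (q − 1)² (q + 1) + 7 < 7 q^m`, i.e. `N < 7 (q^m − 1)/((q − 1)²(q + 1))` (packing only gives
`N ≤ q^m/(q − 1)²`).  Proof: line lemma (`cover_of_sixScalar`) + second-moment cover bound
(`card_mul_lt_of_cover`) applied to the three colour cones, each of size `N (q − 1)²`
(`card_cone`).  Found and proved in the harness (2026-08-15); no published source known.
[folklore] -/
theorem IsSTPP.lineFamily_card_bound [Fintype F] (hq : 3 ≤ Fintype.card F) (hm : 2 ≤ m)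
    (a b c : Fin N → (Fin m → F)) {A B C : Fin N → Finset (Fin m → F)}
    (hne : ∀ i, a i ≠ 0 ∧ b i ≠ 0 ∧ c i ≠ 0)
    (hA : ∀ i v, v ∈ A i ↔ v ≠ 0 ∧ ∃ t : F, v = t • a i)
    (hB : ∀ i v, v ∈ B i ↔ v ≠ 0 ∧ ∃ t : F, v = t • b i)
    (hC : ∀ i v, v ∈ C i ↔ v ≠ 0 ∧ ∃ t : F, v = t • c i) (hS : IsSTPP A B C) :
    N * (Fintype.card F - 1) ^ 2 * (Fintype.card F + 1) + 7 < 7 * Fintype.card F ^ m := by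
  classical
  have h1q : 1 ≤ Fintype.card F := le_trans (by norm_num) hq
  have hkey := hS.sixScalar_of_lineFamily a b c hne hA hB hC
  have hind := hS.lineFamily_independent hq a b c hne hA hB hC
  -- the three cones
  set ES : Finset (Fin m → F) := univ.filter (fun x : Fin m → F =>
    ∃ i, ∃ σ τ : F, σ ≠ 0 ∧ τ ≠ 0 ∧ x = σ • a i - τ • b i) with hESd
  set ET : Finset (Fin m → F) := univ.filter (fun x : Fin m → F =>
    ∃ i, ∃ σ τ : F, σ ≠ 0 ∧ τ ≠ 0 ∧ x = σ • b i - τ • c i) with hETd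
  set EU : Finset (Fin m → F) := univ.filter (fun x : Fin m → F =>
    ∃ i, ∃ σ τ : F, σ ≠ 0 ∧ τ ≠ 0 ∧ x = σ • c i - τ • a i) with hEUd
  have hES : ∀ x, x ∈ ES ↔ ∃ i, ∃ σ τ : F, σ ≠ 0 ∧ τ ≠ 0 ∧ x = σ • a i - τ • b i := fun x => by
    simp [hESd]
  have hET : ∀ x, x ∈ ET ↔ ∃ i, ∃ σ τ : F, σ ≠ 0 ∧ τ ≠ 0 ∧ x = σ • b i - τ • c i := fun x => by
    simp [hETd]
  have hEU : ∀ x, x ∈ EU ↔ ∃ i, ∃ σ τ : F, σ ≠ 0 ∧ τ ≠ 0 ∧ x = σ • c i - τ • a i := fun x => by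
    simp [hEUd]
  -- rotated independence
  have hindT : ∀ (i : Fin N) (α β γ : F), α • b i + β • c i + γ • a i = 0 →
      α = 0 ∧ β = 0 ∧ γ = 0 := by
    intro i α β γ h
    obtain ⟨h1, h2, h3⟩ := hind i γ α β (by rw [← h]; module)
    exact ⟨h2, h3, h1⟩
  have hindU : ∀ (i : Fin N) (α β γ : F), α • c i + β • a i + γ • b i = 0 →
      α = 0 ∧ β = 0 ∧ γ = 0 := by
    intro i α β γ h
    obtain ⟨h1, h2, h3⟩ := hind i β γ α (by rw [← h]; module)
    exact ⟨h3, h1, h2⟩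
  have h0S : (0 : Fin m → F) ∉ ES := by
    intro h0
    obtain ⟨i, σ, τ, hσ, hτ, h⟩ := (hES 0).1 h0
    exact hσ (hind i σ (-τ) 0 (by rw [h]; module)).1
  have h0T : (0 : Fin m → F) ∉ ET := by
    intro h0
    obtain ⟨i, σ, τ, hσ, hτ, h⟩ := (hET 0).1 h0
    exact hσ (hindT i σ (-τ) 0 (by rw [h]; module)).1
  have h0U : (0 : Fin m → F) ∉ EU := by
    intro h0
    obtain ⟨i, σ, τ, hσ, hτ, h⟩ := (hEU 0).1 h0
    exact hσ (hindU i σ (-τ) 0 (by rw [h]; module)).1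
  -- cards of the cones
  have hcS : ES.card = N * (Fintype.card F - 1) ^ 2 := by
    refine card_cone a b c ?_ hind ES hES
    intro i k σ τ σ' τ' hσ hτ hσ' hτ' h
    exact (hkey i k k σ τ τ' 1 1 σ' hσ hτ hτ' one_ne_zero one_ne_zero hσ'
      (by rw [h]; module)).1
  have hcT : ET.card = N * (Fintype.card F - 1) ^ 2 := by
    refine card_cone b c a ?_ hindT ET hET
    intro i k σ τ σ' τ' hσ hτ hσ' hτ' h
    exact (hkey k i k 1 σ' σ τ τ' 1 one_ne_zero hσ' hσ hτ hτ' one_ne_zero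
      (by rw [h]; module)).1.symm
  have hcU : EU.card = N * (Fintype.card F - 1) ^ 2 := by
    refine card_cone c a b ?_ hindU EU hEU
    intro i k σ τ σ' τ' hσ hτ hσ' hτ' h
    exact (hkey k k i τ' 1 1 σ' σ τ hτ' one_ne_zero one_ne_zero hσ' hσ hτ
      (by rw [h]; module)).2.symm
  -- the cover property = the line lemma
  have hcover : ∀ (v w : Fin m → F) (L : Finset (Fin m → F)), v ≠ 0 →
      w ∉ span F ({v} : Set (Fin m → F)) →
      (∀ x, x ∈ L ↔ x ∈ span F ({v, w} : Set (Fin m → F))) →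
      (ES ∩ L).card + 1 ≤ Fintype.card F ∨ (ET ∩ L).card + 1 ≤ Fintype.card F ∨
        (EU ∩ L).card + 3 ≤ 3 * Fintype.card F :=
    fun v w L hv hw hL => cover_of_sixScalar a b c hkey hind ES ET EU hES hET hEU v w L hv hw hL
  have hV : Fintype.card F ^ 2 ≤ Fintype.card (Fin m → F) := by
    rw [Fintype.card_fun, Fintype.card_fin]
    exact Nat.pow_le_pow_right h1q hm
  have hmain := card_mul_lt_of_cover ES ET EU h0S h0T h0U hV hcover
  rw [hcS, hcT, hcU, or_self, or_self, Fintype.card_fun, Fintype.card_fin] at hmain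
  exact hmain

end LineFamilies

end Literature.Computability.AlgebraicComplexity
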